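import Summits.BirchSwinnertonDyer.BirchSwinnertonDyer.Theorems.KatoDescentTamePotSupersingularTameUpperOptimalSharpRoadJ08S2
import Summits.BirchSwinnertonDyer.BirchSwinnertonDyer.Theorems.KimAtThreeKolyvaginIsogenyTransport
import Summits.BirchSwinnertonDyer.Rank1Residual.Additive.X4ThreeResCertKernel
import HarnessLib

/-!
# Route `KatoDescentTamePotSupersingular` (rung K8, sub-rung B4 (t′), cell `bsd-potss`): the BODY of the U₀-ns node
# `TameUpperNonsurjTower` (item 19202) over the TWO-SPLIT Jetchev reading `hJ2` WITHOUT THE L₀ INPUT — the rationality of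
# `L(E₀,1)/Ω(E₀)` at the optimal member is a TREE THEOREM by Manin–Drinfeld (sibling of `…TameUpperOptimalSharpNodesJ08S2`,
# p565100, whose theorem carries the L₀ body `h₂`; seat `bsd-potss-k8t-c4` g13; route-free; nothing booked, no item closed, BSD is
# not proved by any of this)

WHY A SIBLING FILE. The J08 roads of this cell (KT `…TameUpperOptimalSharpNodesJ08`, `…NodesJ08S2`; K9 `…WildUpperOptimalSharpNodesJ08*`)
take the body `h₂` of the L₀ node (`TameLowerHalfRankZero`, item 19981 — an OPEN PROBLEM) and use it at exactly ONE place: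
`#Ш_an(E) ∈ ℚ` ⇒ (Cassels) `#Ш_an(E₀) ∈ ℚ` ⇒ `L(E₀,1)/Ω(E₀) ∈ ℚ` at the optimal member `E₀`. That rationality needs no BSD input:
Manin–Drinfeld for the newform of `E` is PROVED in the tree (`exists_nsmul_modularSymbol_mem_periodLattice_of_isNewformOf`), whence
`IsNewformOf.entireLFunction_one_eq : L(E,1) = [0]⁺_f · Ω⁺_f` with `[0]⁺_f ∈ ℚ`, and the period relation of a parametrisation datum
`ModularParametrizationData.exists_rat_mul_realPeriodRat_eq_plusPeriod : ϖ · Ω(E) = Ω⁺_f`, `ϖ ∈ ℚ_{>0}` (Edixhoven 1991 §1) is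
PROVED; so at the optimal datum `D₀` the road already holds, `L(E₀,1)/Ω(E₀) = [0]⁺ · ϖ ∈ ℚ` (`exists_ratio_rat_of_modularParametrizationData`).
This file is p565100's theorem with the binder `h₂` REMOVED and that lemma in its place (the §3 append to p565100 would exceed the
400-line limit, hence a sibling; the three private re-homings of §1 are repeated verbatim). Consequence for the route: the U₀-ns node —
and with it U₀ `TameUpperDefectRankZero` (item 19982) — does NOT depend on L₀; a re-keyed glue may drop `TameLowerHalfRankZero`
from its binder list (certificates in `…TameUpperNonsurjTowerOfOptimalSharpRoadJ08S2` / `…TameUpperNonsurjTowerOfNamedFacts`).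
Conditional throughout (schema `hJ2`, Coates–Sujatha (A) on the residue rows `hCS`, the LOWER half of the residual `TameRankOne`
at the rank-one (t′) twists `hR`, named published inputs); nothing asserted; NO item closed.

References: [Manin1972] Cor. 3.6; [EdixhovenManin1991] §1; [MazurTateTeitelbaum1986Invent] §I.8 (8.6); [Jetchev2008] Thm. 1.4,
Cor. 1.5, Lemma 4.3, Rem. 6.2; [MatarNekovar2019] Thm. 0.3, §0.11; [GrossLMS1991] Prop. 6.2; [MilneADT2006] I.3.8, I.7.3;
[Kato2004Asterisque] Thm. 14.5 (3); [CoatesSujatha2005] Conj. A; [BurungaleFlach2024] Cor. 2; [SilvermanAEC2009] VII.6;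
[BumpFriedbergHoffstein1990].
-/

set_option autoImplicit false
-- the Theorems directory repeats the summit name (sibling precedent `KatoDescentPotSupersingularAssembly.lean`)
set_option linter.dupNamespace false

noncomputable section

open scoped Classical NumberField

namespace Summit.BirchSwinnertonDyer.BirchSwinnertonDyer.Theorems.TameUpperOptimalSharpNodesJ08S2MD

open WeierstrassCurve IsDedekindDomain IsDedekindDomain.HeightOneSpectrum NumberField
  Rat.HeightOneSpectrum Literature.NumberTheory.EllipticCurves
  Literature.NumberTheory.EllipticCurves.ModularForms
  Literature.NumberTheory.DiophantineGeometry
  Literature.NumberTheory.EllipticCurves.Rank1Residual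
  Literature.NumberTheory.EllipticCurves.Rank1Residual.Typed
  Literature.NumberTheory.Automorphic Literature.NumberTheory.EllipticCurves.KrizLi2019
  Literature.NumberTheory.QuadraticFields
  Summit.BirchSwinnertonDyer.Rank1Residual
  Summit.BirchSwinnertonDyer.Rank1Residual.Additive
  Summit.BirchSwinnertonDyer.BirchSwinnertonDyer.Theorems
  Summit.BirchSwinnertonDyer.BirchSwinnertonDyer.Theorems.TameUpperHeegnerSharpRoad
  Summit.BirchSwinnertonDyer.BirchSwinnertonDyer.Theorems.TameUpperOptimalSharpRoad

/-! ### §1 Private re-homings (the twist of a (t′) row; CM rows; the fine-Selmer port; rationality) -/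

/-- **The Heegner twist of a (t′) row is a (t′) row** (private verbatim re-homing of g2's public
`Theorems.subTprime_twist_of_heegner`, whose module imports the route file): for `W` globally minimal,
additive of type (t′) at `p`, `K` imaginary quadratic of ODD discriminant with the Heegner hypothesis for
`N_E`, every globally minimal model of `E^{(d_K)}` is additive of type (t′) at `p`.
[folklore] [cite: SilvermanATAEC1994, IV.9.4 (PDF pp. 344–346)] [cite: Serre1973, Ch. II §3.3 Thm. 3] -/
private theorem subTprime_twist_of_heegner (W : WeierstrassCurve ℚ) [W.IsElliptic] [W.IsGloballyMinimal]
    (p : ℕ) [Fact p.Prime] (hadd : Addv W p) (hT : SubTprime W p)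
    (K : Type) [Field K] [NumberField K] (hK : IsImaginaryQuadratic K)
    (hHN : SatisfiesHeegnerHypothesis (W.conductorNorm ℤ) K) (hodd : Odd (NumberField.discr K))
    (Wd : WeierstrassCurve ℚ) [Wd.IsElliptic] [Wd.IsGloballyMinimal] (Cd : VariableChange ℚ)
    (hWd : Cd • W.quadraticTwist (NumberField.discr K : ℚ) = Wd) :
    Addv Wd p ∧ SubTprime Wd p := by
  have hp : p.Prime := Fact.out
  have hD0 : (NumberField.discr K : ℚ) ≠ 0 := by exact_mod_cast NumberField.discr_ne_zero K
  have hpN : p ∣ W.conductorNorm ℤ :=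
    (W.dvd_conductorNorm_iff_not_hasGoodReductionAtPrime p).mpr (not_good_of_addv W p hadd)
  have hsq' : IsSquare (algebraMap ℚ ℚ_[p] (NumberField.discr K : ℚ)) :=
    X11b.isSquare_discr_padic_of_heegner K hK hHN p hpN
  have hsq : IsSquare (((NumberField.discr K : ℚ) : ℚ) : ℚ_[p]) := by simpa using hsq'
  have hj : Wd.j = W.j := AdditivePotMult.j_of_model_twist (W := W) hD0 ⟨Cd, hWd⟩
  have haddv : Addv Wd p := (AdditivePotMult.addv_iff_of_twist (W := W) hD0 hsq Wd hWd).mpr hadd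
  have hpd : ¬ ((p : ℕ) : ℤ) ∣ NumberField.discr K :=
    Literature.SatisfiesHeegnerHypothesis.not_dvd_discr hK.1 hHN hp hpN
  have hd4 : NumberField.discr K % 4 = 1 :=
    Literature.NumberTheory.QuadraticFields.Quadratic.discr_emod_four_eq_one hK.1 hodd
  have hf : condExp Wd p = condExp W p := by
    unfold condExp
    refine conductorExponent_eq_of_model_twist_of_not_dvd W Wd hd4 Cd hWd (placeOf p) ?_
    rw [natGenerator_placeOf_eq]
    exact hpd
  have hu : padicValRat p (Cd.u : ℚ) = 0 :=
    AdditivePotMult.padicValRat_u_eq_zero_of_twist_minimal_of_dvd W p K hK hHN hpN Cd hWd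
  have hΔ : padicValRat p Wd.Δ = padicValRat p W.Δ := by
    haveI := W.isElliptic_quadraticTwist hD0
    have hu0 : ((Cd.u⁻¹ : ℚˣ) : ℚ) ≠ 0 := (Cd.u⁻¹).ne_zero
    have hΔ0 : W.Δ ≠ 0 := W.isUnit_Δ.ne_zero
    have hd6 : (NumberField.discr K : ℚ) ^ 6 ≠ 0 := pow_ne_zero 6 hD0
    have hdv : padicValRat p (NumberField.discr K : ℚ) = 0 := by
      rw [padicValRat.of_int, padicValInt.eq_zero_of_not_dvd hpd, Nat.cast_zero]
    have huv : padicValRat p ((Cd.u⁻¹ : ℚˣ) : ℚ) = 0 := by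
      rw [Units.val_inv_eq_inv_val, padicValRat.inv, hu, neg_zero]
    rw [← hWd, variableChange_Δ, quadraticTwist_Δ, padicValRat.mul (pow_ne_zero 12 hu0)
      (mul_ne_zero hd6 hΔ0), padicValRat.mul hd6 hΔ0, padicValRat.pow, padicValRat.pow, huv, hdv]
    ring
  refine ⟨haddv, ?_, ?_, ?_⟩
  · unfold PotMult; rw [hj]; exact hT.1
  · unfold CondExpTwo; rw [hf]; exact hT.2.1
  · rw [semistabilityIndex_dvd_iff Wd p, ← twelve_dvd_padicValRat_Δ_iff Wd p, hΔ,
      twelve_dvd_padicValRat_Δ_iff W p, ← semistabilityIndex_dvd_iff W p]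
    exact hT.2.2

/-- **CM rows of analytic rank `0` have the upper half at every prime** (Burungale–Flach 2024 Cor. 2 via
row C8 `bsdp_cm_rankZero`; private re-homing). [cite: BurungaleFlach2024, Thm. 1.1 and Cor. 2 (p. 4)]
[cite: Miller2011LMS, §1 and Def. 1.1] -/
private theorem missingUpperBoundAt_of_hasCM_rankZero (hCM : bsdTriple_of_hasCM_of_L_one_ne_zero)
    (hmod : hasEntireLFunction_rat) (hGZK : rank_eq_analyticRank_of_analyticRank_le_one)
    (W : WeierstrassCurve ℚ) [W.IsElliptic] [W.IsGloballyMinimal] (p : ℕ) [Fact p.Prime]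
    (hr : W.analyticRank = 0) (hcm : W.HasCM) : MissingUpperBoundAt W p := by
  haveI : Finite W.sha := (hGZK W (by omega)).2
  exact (lower_and_upper_of_missingPPartAt W p
    (missingPPartAt_of_bsdp W p (bsdp_cm_rankZero hCM hmod hcm hr))).2

/-- **The fine-Selmer port of Kato 14.5 (3) on an irreducible rank-`0` (t′) row** (private re-homing of g0's
`Theorems.missingUpperBoundAt_tame_of_irreducible_of_fineSelmerDual_fg`, whose module imports the route): at an
odd additive potentially good `p` with `E[p]` irreducible and `Y(E/ℚ^cyc)` finitely generated over `ℤ_p` (`hA`),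
the upper half (`ord_p #Ш + v_p ∏c_ℓ ≤ ord_p (L/Ω)`, `#Ш_an = (L/Ω)·#tors²/∏c_ℓ`, torsion term killed by
irreducibility). [cite: Kato2004Asterisque, Thm. 14.5 (3) (p. 236), Thm. 12.5 (3) (p. 222), 14.14 (p. 243)]
[cite: Lim2017FineSelmer, §3] [cite: Miller2011LMS, Def. 1.1] -/
private theorem missingUpperBoundAt_tame_of_irreducible_of_fineSelmerDual_fg
    (hKatoA :
      Kato2004.rankZero_padicValNat_sha_add_padicValNat_tamagawa_le_of_additive_potGood_of_irreducible_of_fineSelmerDual_fg)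
    (hGZK : rank_eq_analyticRank_of_analyticRank_le_one) (hmod : hasEntireLFunction_rat)
    (W : WeierstrassCurve ℚ) [W.IsElliptic] [W.IsGloballyMinimal] (p : ℕ) [Fact p.Prime]
    (hr : W.analyticRank = 0) (hp2 : p ≠ 2) (hadd : Addv W p) (hT : SubTprime W p)
    (hirr : W.HasIrreducibleModPGaloisRep p)
    (hA : ∀ (κ : ZpExtension ℚ p), κ.IsCyclotomic →
      ∃ (γ : Field.absoluteGaloisGroup ℚ) (D : W.FineSelmerDualData κ γ),
        Module.Finite ℤ_[p] (RestrictScalars ℤ_[p] (IwasawaAlgebra p) D.X)) :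
    MissingUpperBoundAt W p := by
  have hO5 : ClassO5 W p := ⟨hp2, hadd, Or.inr hT⟩
  have hL : W.entireLFunction 1 ≠ 0 := (W.analyticRank_eq_zero_iff_holds (hmod W)).mp hr
  obtain ⟨hmw, hfin⟩ := hGZK W (by rw [hr]; exact zero_le_one)
  haveI : Finite W.sha := hfin
  have hmw0 : W.mordellWeilRank = 0 := by rw [hmw, hr]
  obtain ⟨q₀, hq₀, hle⟩ := hKatoA W p hp2 hadd.1 hadd.2 hO5.padicValRat_j_nonneg hirr hA hL hfin
  have hΩpos : 0 < W.realPeriodRat := W.realPeriodRat_pos_holds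
  have hΩ : (W.realPeriodRat : ℂ) ≠ 0 := by exact_mod_cast hΩpos.ne'
  have hc0 : 0 < W.tamagawaProduct := W.tamagawaProduct_pos_holds
  have ht0 : 0 < W.torsionOrder := W.torsionOrder_pos_holds
  have hq₀0 : q₀ ≠ 0 := by
    rintro rfl
    rw [Rat.cast_zero, div_eq_zero_iff] at hq₀
    exact hq₀.elim hL hΩ
  refine ⟨q₀ * (W.torsionOrder : ℚ) ^ 2 / (W.tamagawaProduct : ℚ), ?_, ?_⟩
  · have hLq : W.entireLFunction 1 = (q₀ : ℂ) * (W.realPeriodRat : ℂ) := by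
      rw [← hq₀, div_mul_cancel₀ _ hΩ]
    rw [shaAn_def, W.leadingLCoeff_eq_of_analyticRank_eq_zero hr,
      W.regulator_eq_one_of_rank_zero hmw0, hLq]
    push_cast
    field_simp
  · have ht : (W.torsionOrder : ℚ) ≠ 0 := by exact_mod_cast ht0.ne'
    have hcq : (W.tamagawaProduct : ℚ) ≠ 0 := by exact_mod_cast hc0.ne'
    have hsha : padicValNat p (Nat.card (AddCommGroup.primaryComponent W.sha p)) =
        padicValNat p W.shaOrder := by
      unfold WeierstrassCurve.shaOrder
      exact padicValNat_card_addPrimaryComponent p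
    have htors : (padicValNat p W.torsionOrder : ℤ) = 0 := by
      exact_mod_cast padicValNat_torsionOrder_eq_zero_of_irreducible W p hirr
    have hv : padicValRat p (q₀ * (W.torsionOrder : ℚ) ^ 2 / (W.tamagawaProduct : ℚ)) =
        padicValRat p q₀ + 2 * (padicValNat p W.torsionOrder : ℤ) -
          (padicValNat p W.tamagawaProduct : ℤ) := by
      rw [padicValRat.div (mul_ne_zero hq₀0 (pow_ne_zero 2 ht)) hcq,
        padicValRat.mul hq₀0 (pow_ne_zero 2 ht), pow_two, padicValRat.mul ht ht,
        padicValRat.of_nat, padicValRat.of_nat]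
      ring
    rw [hv, ← hsha, htors]
    linarith

/-! ### §2 `L(E,1)/Ω_E ∈ ℚ` by Manin–Drinfeld (tree theorems), and the BODY of the U₀-ns node without L₀ -/

/-- **`L(E,1)/Ω_E ∈ ℚ` from a modular parametrisation datum — PROVED in the tree, no BSD input**: Manin–Drinfeld
for the newform of `E` gives `L(E,1) = [0]⁺_f · Ω⁺_f` with `[0]⁺_f ∈ ℚ` (`IsNewformOf.entireLFunction_one_eq`, over
`exists_nsmul_modularSymbol_mem_periodLattice_of_isNewformOf`), and the period relation of the datum gives `ϖ · Ω(E) = Ω⁺_f`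
with `ϖ ∈ ℚ_{>0}` (`ModularParametrizationData.exists_rat_mul_realPeriodRat_eq_plusPeriod`, Edixhoven 1991 §1); hence
`L(E,1)/Ω(E) = [0]⁺_f · ϖ ∈ ℚ`. This REPLACES the only use the J08 roads make of the L₀ node `TameLowerHalfRankZero`
(`#Ш_an(E) ∈ ℚ`, moved to the optimal member by Cassels). [cite: Manin1972, Cor. 3.6] [cite: EdixhovenManin1991, §1]
[cite: MazurTateTeitelbaum1986Invent, §I.8 (8.6)] -/
private theorem exists_ratio_rat_of_modularParametrizationData (W : WeierstrassCurve ℚ) [W.IsElliptic]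
    [W.IsGloballyMinimal] {N : ℕ} [NeZero N] (D : ModularParametrizationData W N) :
    ∃ q0 : ℚ, W.entireLFunction 1 / (W.realPeriodRat : ℂ) = (q0 : ℂ) := by
  obtain ⟨ϖ, -, hϖ, hΩ⟩ := D.exists_rat_mul_realPeriodRat_eq_plusPeriod
  refine ⟨ratPlusSymbol D.f 0 * ϖ, ?_⟩
  have hΩ0 : (W.realPeriodRat : ℂ) ≠ 0 := by exact_mod_cast hΩ.ne'
  rw [div_eq_iff hΩ0, D.isNewformOf.entireLFunction_one_eq, ← hϖ]
  push_cast
  ring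

/-- **The BODY of the U₀-ns node `TameUpperNonsurjTower` (item 19202) over the two-split reading `hJ2` WITHOUT THE L₀
INPUT** — p565100's theorem (`TameUpperOptimalSharpNodesJ08S2.upperNonsurjTower_of_jetchev08TwoSplit_of_cruxAResidue`) with the binder `h₂` (the body of `TameLowerHalfRankZero`, item 19981, an OPEN PROBLEM) REMOVED:
its single use (rationality of `L(E₀,1)/Ω(E₀)` at the optimal member, via `#Ш_an(E) ∈ ℚ` and Cassels) is discharged by
Manin–Drinfeld at the optimal datum `D₀` (`exists_ratio_rat_of_modularParametrizationData`, tree theorems only). So the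
U₀-ns node rests on: the schema `hJ2`, the Heegner-road published facts, Cassels, Coates–Sujatha's (A) on the residue rows
(`hCS`), the LOWER HALF of the residual `TameRankOne` at the rank-one (t′) twists (`hR`), GZK + modularity (from `hK`) and
the fine-Selmer/CM inputs (`hF`) — and NOT on L₀. Proof otherwise VERBATIM. Conditional; nothing asserted; NO item is
closed. [cite: Jetchev2008, Thm. 1.4, Cor. 1.5 (p. 3), Rem. 6.2 (p. 15)] [cite: Manin1972, Cor. 3.6]
[cite: EdixhovenManin1991, §1] [cite: MatarNekovar2019, Thm. 0.3 (p. 456)] [cite: MilneADT2006, Thm. I.7.3]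
[cite: Kato2004Asterisque, Thm. 14.5 (3) (p. 236)] [cite: CoatesSujatha2005, Conjecture A] [cite: BurungaleFlach2024, Cor. 2] -/
theorem upperNonsurjTower_of_jetchev08TwoSplit_of_cruxAResidue_of_maninDrinfeld
    (hJ2 : ∀ (N : ℕ) [NeZero N] (W : WeierstrassCurve ℚ) [W.IsElliptic] [W.IsGloballyMinimal]
      (K : Type) [Field K] [NumberField K],
      IsImaginaryQuadratic K → NumberField.discr K ≠ -3 → NumberField.discr K ≠ -4 →
      SatisfiesHeegnerHypothesis N K → SatisfiesHeegnerHypothesis 2 K →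
      ∀ (p : ℕ) [Fact p.Prime], p ≠ 2 → W.analyticRank = 0 → Addv W p → 0 ≤ padicValRat p W.j →
      ¬ W.HasCM → W.HasIrreducibleModPGaloisRep p →
      ¬ (∀ n : ℕ, W.HasSurjectiveModNGaloisRep (p ^ n : ℕ)) →
      (∃ Dt : ModularParametrizationData W N,
        (∀ z ∈ Dt.L.lattice, ∃ w ∈ periodLattice Dt.f, z = (Dt.c : ℂ) * w) ∧ ¬ (p : ℤ) ∣ Dt.c) →
      ¬ p ∣ (W.baseChange ℚ_[p]).localTamagawaNumber ℤ_[p] →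
      (∀ (q' : ℕ) [Fact q'.Prime], q' ∣ N →
        p ∣ (W.baseChange ℚ_[q']).localTamagawaNumber ℤ_[q'] → ¬ q' ^ 2 ∣ N) →
      ∀ {P : (W.baseChange K).toAffine.Point}, IsHeegnerPoint N W K P → ¬ IsOfFinAddOrder P →
      ∀ (q : ℕ) [Fact q.Prime], q ∣ N → ¬ q ^ 2 ∣ N → q ≠ p →
      padicValNat p (Nat.card (AddCommGroup.primaryComponent (W.baseChange K).sha p)) +
          2 * padicValNat p ((W.baseChange ℚ_[q]).localTamagawaNumber ℤ_[q]) ≤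
        2 * padicValNat p (AddSubgroup.zmultiples P).index)
    (hGZ : ∀ (N : ℕ) [NeZero N] (W : WeierstrassCurve ℚ) (K : Type) [Field K] [NumberField K],
      gross_zagier N W K)
    (hKo : ∀ (N : ℕ) [NeZero N] (W : WeierstrassCurve ℚ) (K : Type) [Field K] [NumberField K],
      kolyvagin N W K)
    (hMN : ∀ (N : ℕ) [NeZero N] (W : WeierstrassCurve ℚ) (K : Type) [Field K] [NumberField K],
      MatarNekovar2019.thm03_padicValNat_card_sha_le_of_irreducible N W K)
    (hnf : exists_isNewformOf) (hBFH : bumpFriedbergHoffstein_exists_heegnerField_split_twist_simpleZero)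
    (hCassels : bsdRHS_eq_of_isIsogenous)
    (hCS : ∀ (W : WeierstrassCurve ℚ) [W.IsElliptic] [W.IsGloballyMinimal] (p : ℕ) [Fact p.Prime],
      W.analyticRank = 0 → p ≠ 2 → Addv W p → SubTprime W p → ¬ W.HasCM →
      W.HasIrreducibleModPGaloisRep p → ¬ (∀ n : ℕ, W.HasSurjectiveModNGaloisRep (p ^ n : ℕ)) →
      (∃ (W₀ : WeierstrassCurve ℚ) (_ : W₀.IsElliptic) (_ : W₀.IsGloballyMinimal)
          (_ : NeZero (W₀.conductorNorm ℤ)) (D₀ : ModularParametrizationData W₀ (W₀.conductorNorm ℤ)),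
        IsIsogenous W W₀ ∧ (∀ z ∈ D₀.L.lattice, ∃ w ∈ periodLattice D₀.f, z = (D₀.c : ℂ) * w) ∧
        ((p : ℤ) ∣ D₀.c ∨ (p ∣ W₀.tamagawaProduct ∧
          ¬ ∃ (q : ℕ) (_ : Fact q.Prime), q ∣ W₀.conductorNorm ℤ ∧ ¬ q ^ 2 ∣ W₀.conductorNorm ℤ ∧ q ≠ p ∧
            padicValNat p W₀.tamagawaProduct ≤
              padicValNat p ((W₀.baseChange ℚ_[q]).localTamagawaNumber ℤ_[q])))) →
      ∀ (κ : ZpExtension ℚ p), κ.IsCyclotomic →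
        ∃ (γ : Field.absoluteGaloisGroup ℚ) (D : W.FineSelmerDualData κ γ),
          Module.Finite ℤ_[p] (RestrictScalars ℤ_[p] (IwasawaAlgebra p) D.X))
    (hR : ∀ (W : WeierstrassCurve ℚ) [W.IsElliptic] [W.IsGloballyMinimal] (p : ℕ) [Fact p.Prime],
      W.analyticRank = 1 → p ≠ 2 → Addv W p → SubTprime W p → MissingPPartAt W p)
    (hK : Kato2004.rankZero_padicValNat_sha_add_padicValNat_tamagawa_le_of_additive_potGood_of_imageContainsSL2 ∧
      rank_eq_analyticRank_of_analyticRank_le_one ∧ WeierstrassCurve.hasEntireLFunction_rat)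
    (hF : Kato2004.rankZero_padicValNat_sha_add_padicValNat_tamagawa_le_of_additive_potGood_of_irreducible_of_fineSelmerDual_fg ∧
      bsdTriple_of_hasCM_of_L_one_ne_zero) :
    ∀ (W : WeierstrassCurve ℚ) [W.IsElliptic] [W.IsGloballyMinimal] (p : ℕ) [Fact p.Prime],
      W.analyticRank = 0 → p ≠ 2 → Addv W p → SubTprime W p → W.HasIrreducibleModPGaloisRep p →
      ¬ (∀ n : ℕ, W.HasSurjectiveModNGaloisRep (p ^ n : ℕ)) → MissingUpperBoundAt W p := by
  obtain ⟨-, hGZK, hmod⟩ := hK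
  intro W _ _ p _ hr hp2 hadd hT hI hnsT
  haveI : NeZero (W.conductorNorm ℤ) := ⟨(conductorNorm_pos_holds W).ne'⟩
  -- CM rows: Burungale–Flach
  by_cases hcm : W.HasCM
  · exact missingUpperBoundAt_of_hasCM_rankZero hF.2 hmod hGZK W p hr hcm
  -- the optimal member of the class and its lattice-optimal datum (Modularity)
  obtain ⟨W₀, hE₀, hM₀, hNZ₀, D₀, hiso, hN, hopt⟩ := X12.exists_isIsogenous_optimal hnf W
  -- the residue rows: the fine-Selmer port + (A) at `W`
  by_cases hres : (p : ℤ) ∣ D₀.c ∨ (p ∣ W₀.tamagawaProduct ∧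
      ¬ ∃ (q : ℕ) (_ : Fact q.Prime), q ∣ W₀.conductorNorm ℤ ∧ ¬ q ^ 2 ∣ W₀.conductorNorm ℤ ∧ q ≠ p ∧
        padicValNat p W₀.tamagawaProduct ≤ padicValNat p ((W₀.baseChange ℚ_[q]).localTamagawaNumber ℤ_[q]))
  · exact missingUpperBoundAt_tame_of_irreducible_of_fineSelmerDual_fg hF.1 hGZK hmod W p hr hp2 hadd hT hI
      (hCS W p hr hp2 hadd hT hcm hI hnsT ⟨W₀, hE₀, hM₀, hNZ₀, D₀, hiso, hopt, hres⟩)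
  have hc₀ : ¬ (p : ℤ) ∣ D₀.c := fun h ↦ hres (Or.inl h)
  have hsingle₀ : p ∣ W₀.tamagawaProduct → ∃ (q : ℕ) (_ : Fact q.Prime), q ∣ W₀.conductorNorm ℤ ∧
      ¬ q ^ 2 ∣ W₀.conductorNorm ℤ ∧ q ≠ p ∧
      padicValNat p W₀.tamagawaProduct ≤ padicValNat p ((W₀.baseChange ℚ_[q]).localTamagawaNumber ℤ_[q]) := by
    intro ht
    by_contra hne
    exact hres (Or.inr ⟨ht, hne⟩)
  -- the `v ∣ p` binder at `W₀`: automatic (§2, or `c_p ∣ ∏c_ℓ` when `p ∤ ∏c_ℓ`)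
  have hcp₀ : ¬ p ∣ (W₀.baseChange ℚ_[p]).localTamagawaNumber ℤ_[p] := by
    by_cases ht : p ∣ W₀.tamagawaProduct
    · obtain ⟨q, hqF, -, -, hqp, hle⟩ := hsingle₀ ht
      haveI : Fact q.Prime := hqF
      exact TameUpperOptimalSharpNodesMult.not_dvd_localTamagawaNumber_padic_of_single W₀ p q hqp hle
    · exact fun h ↦ ht (dvd_trans h (localTamagawaNumber_padic_dvd_tamagawaProduct W₀ p))
  -- transports along `W ∼ W₀`: analytic rank, additivity with integral `j`, CM, `E[p]`, the `p`-adic tower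
  have hr₀ : W₀.analyticRank = 0 := by rw [← analyticRank_eq_of_isIsogenous' hiso]; exact hr
  have hj : 0 ≤ padicValRat p W.j := not_lt.mp hT.1
  obtain ⟨hadd₀, hj₀⟩ := Addv.of_isIsogenous_of_padicValRat_j_nonneg (p := p) hadd hj hiso
  obtain ⟨e, he⟩ :=
    Summit.BirchSwinnertonDyer.BirchSwinnertonDyer.Rank1Residual.exists_torsionIso_of_isIsogenous_of_irreducible
      (p := p) hI hiso
  have hI₀ : W₀.HasIrreducibleModPGaloisRep p :=
    GreenbergVatsal2000.hasIrreducibleModPGaloisRep_of_torsionIso e he hI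
  have hns₀ : ¬ (∀ n : ℕ, W₀.HasSurjectiveModNGaloisRep (p ^ n : ℕ)) := fun h ↦
    hnsT (KimAtThreeKolyvaginIsogenyTransport.towerSurjective_of_isIsogenous hiso.symm_of_charZero h)
  have hcm₀ : ¬ W₀.HasCM := fun h ↦ hcm ((X12.hasCM_iff_of_isIsogenous hiso).mpr h)
  -- rationality of `L(E₀,1)/Ω(E₀)`: Manin–Drinfeld at the optimal datum `D₀` (tree theorems; NO L₀ input)
  have hrat₀ := exists_ratio_rat_of_modularParametrizationData W₀ D₀
  -- the twists' lower halves: `TameRankOne` at the minimal model of `E^{(d_K)}` ((t′), §1), moved by Cassels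
  have hlow₀ : ∀ (K : Type) [Field K] [NumberField K], IsImaginaryQuadratic K →
      SatisfiesHeegnerHypothesis (W₀.conductorNorm ℤ) K → Odd (NumberField.discr K) →
      ∀ (Wd : WeierstrassCurve ℚ) [Wd.IsElliptic] [Wd.IsGloballyMinimal] (Cd : VariableChange ℚ),
        Cd • W₀.quadraticTwist (NumberField.discr K : ℚ) = Wd → Wd.analyticRank = 1 →
        MissingLowerBoundAt Wd p := by
    intro K _ _ hKq hHN₀ hodd Wd₀ _ _ Cd₀ hWd₀ hrd₀
    have hHN : SatisfiesHeegnerHypothesis (W.conductorNorm ℤ) K := by rw [← hN]; exact hHN₀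
    have hD0 : (NumberField.discr K : ℚ) ≠ 0 := by exact_mod_cast NumberField.discr_ne_zero K
    haveI : (W.quadraticTwist (NumberField.discr K : ℚ)).IsElliptic := W.isElliptic_quadraticTwist hD0
    haveI : (W₀.quadraticTwist (NumberField.discr K : ℚ)).IsElliptic := W₀.isElliptic_quadraticTwist hD0
    obtain ⟨Cd, hCd⟩ := hasGlobalMinimalModel_rat_holds (W.quadraticTwist (NumberField.discr K : ℚ))
    haveI : (Cd • W.quadraticTwist (NumberField.discr K : ℚ)).IsGloballyMinimal := hCd
    obtain ⟨haddd, hTd⟩ := subTprime_twist_of_heegner W p hadd hT K hKq hHN hodd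
      (Cd • W.quadraticTwist (NumberField.discr K : ℚ)) Cd rfl
    haveI : NeZero (2 : ℚ) := ⟨two_ne_zero⟩
    have hisoT : IsIsogenous (Cd • W.quadraticTwist (NumberField.discr K : ℚ)) Wd₀ := by
      rw [← hWd₀]
      exact IsIsogenous.trans' (IsIsogenous.trans' (isIsogenous_of_smul _ Cd) (hiso.quadraticTwist hD0))
        (isIsogenous_smul _ Cd₀)
    have hrd : (Cd • W.quadraticTwist (NumberField.discr K : ℚ)).analyticRank = 1 := by
      rw [analyticRank_eq_of_isIsogenous' hisoT]; exact hrd₀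
    have hlowd : MissingLowerBoundAt (Cd • W.quadraticTwist (NumberField.discr K : ℚ)) p :=
      (lower_and_upper_of_missingPPartAt _ p (hR _ p hrd hp2 haddd hTd)).1
    have hfind : Finite (Cd • W.quadraticTwist (NumberField.discr K : ℚ)).sha :=
      (hGZK _ (by rw [hrd])).2
    have hleadd : (Cd • W.quadraticTwist (NumberField.discr K : ℚ)).leadingLCoeff ≠ 0 :=
      (Cd • W.quadraticTwist (NumberField.discr K : ℚ)).leadingLCoeff_ne_zero_holds (hmod _)
    exact X12.missingLowerBoundAt_of_isIsogenous hCassels hisoT.symm_of_charZero hfind hleadd hlowd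
  -- the upper half at the optimal member, then back to `W` by Cassels
  have hup₀ : MissingUpperBoundAt W₀ p :=
    TameUpperOptimalSharpRoadJ08S2.missingUpperBoundAt_rankZero_of_optimalDatum_of_jetchev08TwoSplit hGZ hKo hMN hGZK
      hmod hnf hBFH hJ2 W₀ p hr₀ hp2 hadd₀ hj₀ hcm₀ hI₀ hns₀ hcp₀ D₀ hopt hc₀ hsingle₀ hrat₀ hlow₀
  have hfin₀ : Finite W₀.sha := (hGZK W₀ (by rw [hr₀]; exact zero_le_one)).2
  have hlead₀ : W₀.leadingLCoeff ≠ 0 := W₀.leadingLCoeff_ne_zero_holds (hmod W₀)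
  exact X12.missingUpperBoundAt_of_isIsogenous hCassels hiso hfin₀ hlead₀ hup₀


end Summit.BirchSwinnertonDyer.BirchSwinnertonDyer.Theorems.TameUpperOptimalSharpNodesJ08S2MD

end
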